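import Summits.ResolutionOfSingularities.ResolutionOfSingularities.Theorems.MarkedTransferCampaignW12SandwichF2Cell
import HarnessLib

/-!
# [OURS · L1 G1 · scored cell F9 `root_closed` × SW / SWρ] KERNEL: `p`-th-root closure FAILS for the Frobenius-sandwich negative
# pieces at the guarded affine-line model, for EVERY admissible `m ≥ 2` (res-type-009, res-D-plan-1 ROUTING #12 (a) 2026-08-27T02:56:49Z
# — scorer res-adj-1, carrier res-L1-type-o2; HOME draft `D/res-type-009/F9RootClosedSW.draft.lean` sha16 6c490d3497398e0e, re-based
# here on the MODEL DATA of the sibling cell file `MarkedTransferCampaignW12SandwichF2Cell.lean` (res-type-017 / o2, p491700 · p492104):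
# same `A = 𝔽₂[x]`, `P j = (x)^j`, `T`, `T₂`, `T_ρ`, `tilde2` — nothing re-declared)

WHAT IS DECIDED (a SCORED-CELL kernel, NOT a verdict on the manuscript). Field F9 of the checklist of record
`Campaign.PnegaInterfaceV3.root_closed` (p487629): «for reduced `B`, admissible `P`, `b : B`, `i ≤ 0`: `b^p ∈ tilde P (p·i) → b ∈ tilde P i`»
(degree convention C3). For the W1.2 candidate SW the degree-`i` piece (`i ≤ 0`) is `℘̃_sw(E,i) = Campaign.sandwichPTildeNeg p e P m (−i)`
(`= Campaign.sandwichPNega p e P m a` at `i = −a`); for SWρ the `ρ^e`-modules `Campaign.sandwichPNegaRho` (p488714). MODEL (res-adj-1's model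
of record, guard re-proved as `F2CellSW.isCharFiltration_P`): `A = 𝔽₂[x]`, `P j = (x)^j` ((37) at `(q,g) = (1,x)`), sandwich base `ρ(A) = 𝔽₂[x²]`
(`p = 2`, `e = 1`); `A` is reduced (a domain).

* §1 `m = 2` — EXACT, on res-type-017's closed form `F2CellSW.T2_eq` («`T₂(−a) = (x^{2⌈max(a,1)/2⌉})`») and its by-fiat extension
  `F2CellSW.tilde2`: `tilde2 0 = tilde2 (−1) = tilde2 (−2) = (x²)`, so `b = x` has `b² ∈ tilde2 (2·i)` and `b ∉ tilde2 i` at BOTH `i = 0`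
  and `i = −1` (`not_rootClosed_tilde2_zero`, `not_rootClosed_tilde2_neg_one`); field shape: `not_rootClosed_SW_m2`. (Hand, not kernel:
  at `i = −a`, `a ≥ 2` EVEN, the implication holds — `x^{2a} ∣ b² ⇒ x^a ∣ b` — and at odd `a` it fails with `b = x^a`; so at `m = 2` the
  cell is ✓ exactly on `i ∈ {−2, −4, …}`.)
* §2 EVERY `m ≥ 2` — `T_m(−1) := ℘nega_sw(E,−1) ⊆ (x^{2⌊m/2⌋})` (`sandwichPNega_one_le`: each summand `d ≥ 1` acts on `(x^{dm}) ⊆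
  (x^{2⌊m/2⌋}) = ρ(x^{⌊m/2⌋})·A`, an ideal generated by a sandwich CONSTANT, hence stable under every `ρ`-linear operator — tree
  `W12.diffIdeal_le_span`), while `x^{2⌊m/2⌋} ∈ T_m(−2)` (`X_pow_mem_sandwichPNega_two`: `m` even — `x^m ∈ ℘(E,m)` and the identity
  operator; `m` odd — `∂^{(1)}(x^m) = m·x^{m−1} = x^{m−1}`, `∂^{(1)}` a sandwich operator of order `1`, tree `W12.exists_sandwichOp_hasseDeriv`),
  and `x^{⌊m/2⌋} ∉ (x^{2⌊m/2⌋})` (`X_pow_not_mem_span_X_pow_two_mul`). Hence `not_rootClosed_SW : ∀ m ≥ 2, ¬ (F9 shape for ℘̃_sw,m)`,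
  witness `b = x^{⌊m/2⌋}`, `i = −1`. `m = 1` is the UNIT regime: `℘nega_sw(E,−1) = A ∋ ∂x = 1` (`sandwichPNega_one_eq_top_of_m_one`; F7b ✗
  there), where F9 holds (hand: `T₁(−a) = (x^{2⌊a/2⌋})`). So at the model: **F9 × SW ✗ for every `m ≥ 2 = p^e` (the no-unit regime), ✓
  only at `m = 1`.**
* §3 SWρ — same witness at `m = 3` on res-type-017's `F2CellSW.Tρ`: `x² = ∂(x³) ∈ T_ρ(−2)` (`F2CellSW.X_sq_mem_Tρ`), `x ∉ T_ρ(−1) ⊆ T(−1) ⊆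
  (x²)` (`not_rootClosed_SWrho`).
MECHANISM (no side taken on the manuscript): every SW piece is a sum of order-truncated `ρ^e`-hulls `Σ_{|γ| ≤ k} A·∂^{(γ)}(℘(E,dm))`; these
are closed under extraction of `p^e`-th-power COEFFICIENTS, not under `p`-th roots of ELEMENTS — nothing in the shape of Eq. (36) re-based
on `ρ^e` supplies the root step that U54L42 p.54 / Th 9.18 p.55 L34–L37 ask of `℘̃`.

HONEST FRAMING. Statements about OURS objects (`Campaign.sandwichPNega`, `Campaign.sandwichPTildeNeg`, `Campaign.sandwichPNegaRho`) at ONE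
model; Def 5.1 / Eq. (36) (p.25 L31–L44) and U54L42 / Th 9.18 of H. Hironaka's manuscript *Resolution of singularities in positive
characteristics* (2017-03-23, [Hironaka2017], lit key `paper:url-3343fd9e678b`) enter only as the typed SHAPES, CANDIDATES
[claim: Hironaka2017, status: under-review]; nothing of the manuscript is asserted or denied. No new definitions (the model data are
res-type-017's). AI proof, weaker than expert review; nothing here is progress on resolution of singularities in positive characteristic;
no claim beyond the kernel.
-/

noncomputable section

set_option linter.dupNamespace false -- mandated namespace of this single-conjunct summit

namespace Summit.ResolutionOfSingularities.ResolutionOfSingularities.Theorems.Campaign.W12.F9CellSW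

open MvPolynomial
open Literature.AlgebraicGeometry.Resolution
open Literature.AlgebraicGeometry.Hironaka2017
open Summit.ResolutionOfSingularities.ResolutionOfSingularities.Theorems.Campaign
open Summit.ResolutionOfSingularities.ResolutionOfSingularities.Theorems.Campaign.W12 (apply_mem_sandwichPNega
  exists_sandwichOp_hasseDeriv diffIdeal_le_span sandwichPNega_eq_top_of_isUnit)
open Summit.ResolutionOfSingularities.ResolutionOfSingularities.Theorems.Campaign.W12.F2CellSW

/-! ## §0 Monomial non-membership in `𝔽₂[x]` -/

/-- `x^k ∉ (x^{2k})` for `k ≥ 1` (transfer to `Polynomial (ZMod 2)` and compare degrees, as `F2CellSW.X4_not_mem_span_X6`). [folklore] -/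
theorem X_pow_not_mem_span_X_pow_two_mul {k : ℕ} (hk : 1 ≤ k) :
    (X 0 : A) ^ k ∉ Ideal.span {(X 0 : A) ^ (2 * k)} := by
  intro h
  obtain ⟨g, hg⟩ := Ideal.mem_span_singleton'.mp h
  have hdvd : (Polynomial.X : Polynomial (ZMod 2)) ^ (2 * k) ∣ Polynomial.X ^ k := by
    have h' := congrArg (MvPolynomial.aeval (R := ZMod 2) fun _ : Fin 1 => (Polynomial.X : Polynomial (ZMod 2))) hg
    simp only [map_mul, map_pow, MvPolynomial.aeval_X] at h'
    exact ⟨_, by rw [← h', mul_comm]⟩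
  have hdeg := Polynomial.natDegree_le_of_dvd hdvd (pow_ne_zero k Polynomial.X_ne_zero)
  simp at hdeg
  omega

/-- `x ∉ (x²)`. [folklore] -/
theorem X_not_mem_span_X_sq : (X 0 : A) ∉ Ideal.span {(X 0 : A) ^ 2} := by
  simpa using X_pow_not_mem_span_X_pow_two_mul (k := 1) le_rfl

/-! ## §1 `m = 2`: exact pieces (res-type-017's `T2_eq` / `tilde2_eq`) and the F9 witnesses at `i = 0`, `i = −1` -/

/-- `tilde2 0 = (x²)` (`nexp 0 = texp 0 = 2`). [folklore] -/
theorem tilde2_zero : tilde2 0 = Ideal.span {(X 0 : A) ^ 2} := by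
  rw [tilde2_eq]; rfl

/-- `tilde2 (−1) = (x²)` (`texp 1 = 2`). [folklore] -/
theorem tilde2_neg_one : tilde2 (-1) = Ideal.span {(X 0 : A) ^ 2} := by
  rw [tilde2_eq]; rfl

/-- `tilde2 (−2) = (x²)` (`texp 2 = 2`). [folklore] -/
theorem tilde2_neg_two : tilde2 (-2) = Ideal.span {(X 0 : A) ^ 2} := by
  rw [tilde2_eq]; rfl

/-- **F9 ✗ at `i = 0`, `m = 2`**: `x² ∈ tilde2 (2·0) = (x²)`, `x ∉ tilde2 0 = (x²)`. [folklore] -/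
theorem not_rootClosed_tilde2_zero : ¬ (∀ b : A, b ^ 2 ∈ tilde2 (2 * 0) → b ∈ tilde2 0) := by
  intro h
  have h1 := h (X 0) (by rw [mul_zero, tilde2_zero]; exact Ideal.mem_span_singleton_self _)
  rw [tilde2_zero] at h1
  exact X_not_mem_span_X_sq h1

/-- **F9 ✗ at `i = −1`, `m = 2`**: `x² ∈ tilde2 (−2) = (x²)`, `x ∉ tilde2 (−1) = (x²)`. [folklore] -/
theorem not_rootClosed_tilde2_neg_one : ¬ (∀ b : A, b ^ 2 ∈ tilde2 (2 * (-1)) → b ∈ tilde2 (-1)) := by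
  intro h
  have h1 := h (X 0) (by rw [show (2 : ℤ) * (-1) = -2 by norm_num, tilde2_neg_two]; exact Ideal.mem_span_singleton_self _)
  rw [tilde2_neg_one] at h1
  exact X_not_mem_span_X_sq h1

/-- **Cell F9 × SW = ✗ at `m = 2`, field shape** (V3 `root_closed` with `tilde := F2CellSW.tilde2`, the SW value with positive degrees
by fiat; guard `F2CellSW.isCharFiltration_P`; `A` reduced): killed at `i = −1` (and at `i = 0`) by `b = x`. [folklore] -/
theorem not_rootClosed_SW_m2 :
    IsCharFiltration (ZMod 2) P ∧ IsReduced A ∧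
      ¬ (∀ (b : A) (i : ℤ), i ≤ 0 → b ^ 2 ∈ tilde2 (2 * i) → b ∈ tilde2 i) :=
  ⟨isCharFiltration_P, inferInstance, fun h => not_rootClosed_tilde2_neg_one fun b hb => h b (-1) (by norm_num) hb⟩

/-! ## §2 Every `m ≥ 2`: `℘nega_sw(E,−1) ⊆ (x^{2⌊m/2⌋}) ∌ x^{⌊m/2⌋}` while `x^{2⌊m/2⌋} ∈ ℘nega_sw(E,−2)` -/

/-- `(x^n) ⊆ (x^{2⌊m/2⌋})` for `n ≥ m`. [folklore] -/
theorem span_X_pow_le {m n : ℕ} (h : m ≤ n) :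
    Ideal.span {(X 0 : A) ^ n} ≤ Ideal.span {(X 0 : A) ^ (2 * (m / 2))} :=
  Ideal.span_singleton_le_span_singleton.mpr (pow_dvd_pow _ (by omega))

/-- **`℘nega_sw(E,−1) ⊆ (x^{2⌊m/2⌋})` for every `m ≥ 1`**: each summand `d` of Eq. (36) re-based (`|−1| ≤ dm` forces `d ≥ 1`) is
`Diff^{(dm+1)}_{A/𝔽₂[x²]}·(x^{dm})` with `(x^{dm}) ⊆ (x^{2⌊m/2⌋}) = 𝔽₂[x]·ρ(x^{⌊m/2⌋})`, an ideal generated by a sandwich constant and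
therefore stable under every sandwich operator (tree `W12.diffIdeal_le_span`). [folklore] -/
theorem sandwichPNega_one_le (m : ℕ) (hm : 1 ≤ m) :
    sandwichPNega (O := A) 2 1 P m 1 ≤ Ideal.span {(X 0 : A) ^ (2 * (m / 2))} := by
  unfold sandwichPNega S05NegativePart.pNega S05NegativePart.pTildeNeg S05NegativePart.DD
  refine iSup₂_le fun d hd => ?_
  have hd1 : (1 : ℤ) ≤ d := by
    simp only [Nat.cast_one, abs_one] at hd
    have : (1 : ℤ) ≤ (m : ℤ) := by exact_mod_cast hm
    nlinarith
  refine diffIdeal_le_span (p := 2) 1 _ ?_ ?_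
  · rintro s hs
    rcases hs with rfl
    exact ⟨(X 0 : A) ^ (m / 2), by rw [iterateFrobenius_def, pow_one, ← pow_mul, mul_comm]⟩
  · have hmd : (m : ℤ) ≤ d * m := by
      have : (0 : ℤ) ≤ (m : ℤ) := by positivity
      nlinarith
    have hne : (d * (m : ℤ)).toNat ≠ 0 := by
      simp only [ne_eq, Int.toNat_eq_zero, not_le]
      have : (1 : ℤ) ≤ (m : ℤ) := by exact_mod_cast hm
      nlinarith
    unfold S05NegativePart.pPosi
    rw [if_neg hne, P_eq_span]
    refine span_X_pow_le ?_
    rw [Int.le_toNat (by positivity)]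
    exact hmd

/-- `x^{⌊m/2⌋} ∉ ℘nega_sw(E,−1)` for every `m ≥ 2`. [folklore] -/
theorem X_pow_half_not_mem_sandwichPNega_one (m : ℕ) (hm : 2 ≤ m) :
    (X 0 : A) ^ (m / 2) ∉ sandwichPNega (O := A) 2 1 P m 1 := fun h =>
  X_pow_not_mem_span_X_pow_two_mul (k := m / 2) (by omega) (sandwichPNega_one_le m (by omega) h)

/-- **`x^{2⌊m/2⌋} ∈ ℘nega_sw(E,−2)` for every `m ≥ 2`** (summand `d = 1`, `a = 2 ≤ m`): for EVEN `m`, `x^{2⌊m/2⌋} = x^m ∈ ℘(E,m)` and the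
identity operator; for ODD `m`, `∂^{(1)}(x^m) = m·x^{m−1} = x^{m−1} = x^{2⌊m/2⌋}` (`m = 1` in `𝔽₂`), `∂^{(1)}` a sandwich operator of order
`1 ≤ m + 2` (`W12.exists_sandwichOp_hasseDeriv`). [folklore] -/
theorem X_pow_mem_sandwichPNega_two (m : ℕ) (hm : 2 ≤ m) :
    (X 0 : A) ^ (2 * (m / 2)) ∈ sandwichPNega (O := A) 2 1 P m 2 := by
  classical
  rcases Nat.even_or_odd m with ⟨k, hk⟩ | ⟨k, hk⟩
  · -- `m = k + k`: the identity operator on `x^m ∈ ℘(E,m)`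
    have heq : 2 * (m / 2) = 1 * m := by omega
    rw [heq]
    have hmem := apply_mem_sandwichPNega (O := A) 2 1 P m 2 1 (by omega) (by omega)
      (D := LinearMap.id) ((isDiffOpLE_id (R := ↥(iterateFrobenius A 2 1).range) (A := A)).of_le (Nat.zero_le _))
      (f := (X 0 : A) ^ (1 * m)) (X_pow_mem_P _)
    simpa using hmem
  · -- `m = 2k + 1`: the Hasse derivative `∂^{(1)}` on `x^m ∈ ℘(E,m)`
    have hγ : ∀ i : Fin 1, (Finsupp.single (0 : Fin 1) 1) i < 2 ^ 1 := by
      intro i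
      fin_cases i
      simp
    obtain ⟨D, hD, hDf⟩ := exists_sandwichOp_hasseDeriv (R := ZMod 2) (σ := Fin 1) 2 1 hγ
    have hdeg : (Finsupp.single (0 : Fin 1) 1).degree = 1 := by simp [Finsupp.degree_single]
    rw [hdeg] at hD
    have hmem := apply_mem_sandwichPNega (O := A) 2 1 P m 2 1 (by omega) (by omega) (hD.of_le (by omega))
      (f := (X 0 : A) ^ (1 * m)) (X_pow_mem_P _)
    have hcast : ((m : ℕ) : A) = 1 := by
      have h2 : ((m : ℕ) : ZMod 2) = 1 := by
        rw [ZMod.natCast_eq_one_iff_odd]; exact ⟨k, hk⟩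
      rw [← map_natCast (algebraMap (ZMod 2) A) m, h2, map_one]
    rw [hDf, one_mul, hasseDeriv_X_pow, Nat.choose_one_right, hcast, one_mul] at hmem
    have heq : 2 * (m / 2) = m - 1 := by omega
    rw [heq]
    exact hmem

/-- **Cell F9 × SW = ✗ for EVERY admissible `m ≥ 2`, field shape** (V3 `root_closed`, degree convention `p·i ↦ i`, with the SW pieces
`tilde P i := ℘̃_sw(E,i) = Campaign.sandwichPTildeNeg 2 1 P m (−i)`; guard `F2CellSW.isCharFiltration_P`, `A` reduced): killed at `i = −1` by
`b = x^{⌊m/2⌋}`. [folklore] -/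
theorem not_rootClosed_SW (m : ℕ) (hm : 2 ≤ m) :
    ¬ (∀ (b : A) (i : ℤ), i ≤ 0 →
        b ^ 2 ∈ sandwichPTildeNeg (O := A) 2 1 P m (-(2 * i)) → b ∈ sandwichPTildeNeg (O := A) 2 1 P m (-i)) := by
  intro h
  have h1 := h ((X 0 : A) ^ (m / 2)) (-1) (by norm_num)
  have e2 : (-(2 * (-1 : ℤ))) = ((2 : ℕ) : ℤ) := by norm_num
  have e1 : (-(-1 : ℤ)) = ((1 : ℕ) : ℤ) := by norm_num
  rw [e2, e1, ← pow_mul, Nat.mul_comm] at h1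
  exact X_pow_half_not_mem_sandwichPNega_one m hm (h1 (X_pow_mem_sandwichPNega_two m hm))

/-- **`m = 1` is the unit regime**: `℘nega_sw(E,−1) = 𝔽₂[x]`, since `∂^{(1)} x = 1` is the value of a sandwich operator of order
`1 ≤ 1·1 + 1` on `x ∈ ℘(E,1)` (box regime of the K1.2 criterion; F7b-unit ✗ there) — so the F9 failure above sits exactly in the no-unit
regime `m ≥ 2 = p^e`. [folklore] -/
theorem sandwichPNega_one_eq_top_of_m_one : sandwichPNega (O := A) 2 1 P 1 1 = ⊤ := by
  classical
  have hγ : ∀ i : Fin 1, (Finsupp.single (0 : Fin 1) 1) i < 2 ^ 1 := by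
    intro i
    fin_cases i
    simp
  obtain ⟨D, hD, hDf⟩ := exists_sandwichOp_hasseDeriv (R := ZMod 2) (σ := Fin 1) 2 1 hγ
  have hdeg : (Finsupp.single (0 : Fin 1) 1).degree = 1 := by simp [Finsupp.degree_single]
  rw [hdeg] at hD
  have hval : D ((X 0 : A) ^ (1 * 1)) = 1 := by
    rw [hDf, hasseDeriv_X_pow]; simp
  exact sandwichPNega_eq_top_of_isUnit (O := A) 2 1 P 1 1 1 (by norm_num) (by norm_num) (hD.of_le (by norm_num))
    (X_pow_mem_P _) (by rw [hval]; exact isUnit_one)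

/-! ## §3 SWρ: the same witness on res-type-017's `T_ρ(−a) = Campaign.sandwichPNegaRho 2 1 P 3 a` -/

/-- `x ∉ T_ρ(−1)` (`T_ρ ⊆ T` as sets, `sandwichPNegaRho_subset`; `T(−1) ⊆ (x²)` by §2 at `m = 3`). [folklore] -/
theorem X_not_mem_Tρ_one : (X 0 : A) ∉ Tρ 1 := fun h =>
  X_pow_half_not_mem_sandwichPNega_one 3 (by norm_num) (by simpa using sandwichPNegaRho_subset (O := A) 2 1 P 3 1 h)

/-- **Cell F9 × SWρ = ✗** (`m = 3`; field shape with `tilde P i := Campaign.sandwichPTildeNegRho 2 1 P 3 (−i)`): `x² = ∂(x³) ∈ T_ρ(−2)`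
(`F2CellSW.X_sq_mem_Tρ`), `x ∉ T_ρ(−1)`. [folklore] -/
theorem not_rootClosed_SWrho :
    ¬ (∀ (b : A) (i : ℤ), i ≤ 0 →
        b ^ 2 ∈ sandwichPTildeNegRho (O := A) 2 1 P 3 (-(2 * i)) → b ∈ sandwichPTildeNegRho (O := A) 2 1 P 3 (-i)) := by
  intro h
  have h1 := h (X 0) (-1) (by norm_num)
  have e2 : (-(2 * (-1 : ℤ))) = ((2 : ℕ) : ℤ) := by norm_num
  have e1 : (-(-1 : ℤ)) = ((1 : ℕ) : ℤ) := by norm_num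
  rw [e2, e1] at h1
  exact X_not_mem_Tρ_one (h1 (X_sq_mem_Tρ (a := 2) (by norm_num)))

/-- **THE CELL WORD, kernel part** (scored by res-adj-1, not here): at the guarded reduced model `𝔽₂[x]`, `P = (x)`-adic, `p = 2`, `e = 1`:
F9 `root_closed` FAILS for SW at every `m ≥ 2` (witness `x^{⌊m/2⌋}`, `i = −1`; at `m = 2` also at `i = 0`) and for SWρ (`m = 3`), while
`m = 1` is the unit regime `℘nega_sw(E,−1) = ⊤`. [folklore] -/
theorem F9_root_closed_SW_fails :
    IsCharFiltration (ZMod 2) P ∧ IsReduced A ∧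
      (∀ m : ℕ, 2 ≤ m → ¬ (∀ (b : A) (i : ℤ), i ≤ 0 →
        b ^ 2 ∈ sandwichPTildeNeg (O := A) 2 1 P m (-(2 * i)) → b ∈ sandwichPTildeNeg (O := A) 2 1 P m (-i))) ∧
      ¬ (∀ (b : A) (i : ℤ), i ≤ 0 →
        b ^ 2 ∈ sandwichPTildeNegRho (O := A) 2 1 P 3 (-(2 * i)) → b ∈ sandwichPTildeNegRho (O := A) 2 1 P 3 (-i)) ∧
      sandwichPNega (O := A) 2 1 P 1 1 = ⊤ :=
  ⟨isCharFiltration_P, inferInstance, not_rootClosed_SW, not_rootClosed_SWrho, sandwichPNega_one_eq_top_of_m_one⟩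

end Summit.ResolutionOfSingularities.ResolutionOfSingularities.Theorems.Campaign.W12.F9CellSW

end
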